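import Literature.MathematicalPhysics.QuantumFieldTheory.Balaban1983to89.Beta.RemainderOriginBaseLetters
import Literature.MathematicalPhysics.QuantumFieldTheory.Balaban1983to89.Beta.RemainderInvQGQNewG

/-!
# Bałaban, *The variational problem and background fields in renormalization group method for lattice gauge
# theories*, Commun. Math. Phys. **102** (1985) 277–309 — the (190) letter of `(δ/δB)𝓗(0) = H₀ + G̃Δ⁽²⁾H₀` in a background
# FROM TWO LETTERS: [5] Thm 3.3 (3.42) for `G₀ = Δ_a⁻¹` and the (3.132)-shape bound of `(QG₀Q*)⁻¹` — with `H₀` (129),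
# the new `G′ = (Δ_a − Δ⁽²⁾)⁻¹` (p. 306), `(QG′Q*)⁻¹` and `G̃ = G′P₀′*` ((131)/(180)) ALL DERIVED, and `(QG′Q*)⁻¹` CONSTRUCTED on finite carriers

CITATION HEADER (lean-in-tree rule 2026-08-18).  Source: T. Bałaban, Commun. Math. Phys. **102** (1985) 277–309,
doi:10.1007/BF01229381 [Balaban1985Variational] (cell paper B11 = [15] of [Balaban1987RG1]; held
`paper:balaban1985-cmp102-variational-background`, journal page = PDF page + 276); its ref. [5] = T. Bałaban, *Propagators for
lattice gauge theories in a background field*, Commun. Math. Phys. **99** (1985) 389–434 [Balaban1985BackgroundPropagators] (B9); its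
ref. [3] = *Propagators and renormalization transformations for lattice gauge theories. II*, Commun. Math. Phys. **96** (1984) 223–250
[Balaban1984PropagatorsII] (B6).  Passages used (read in the siblings' quotations, locators theirs): p. 297 after (128) *"Δ_a = Δ +
DRD* + Q*aQ (the constant a = 1). For the operator Δ_a⁻¹ = G we have proved Theorem 3.3 in [5], and especially the bounds (3.42)"*;
(129) *"H₀B = GQ*(QGQ*)⁻¹(L^{j(·)}η)⁻¹B … satisfies the bound (3.133) [5]"*; (131) p. 298; p. 300 *"GP₀* = … = G̃"*; p. 306 after
(179) *"the new operator G has exactly the same properties as Δ_a⁻¹"* (cell GAPS G-B11-G1); (180); (182) p. 307; (190) p. 308; [5]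
(3.42) p. 397, (3.132)–(3.133) p. 422 (*"The above inequality [(3.132)] together with Theorem 3.3 for G … give (3.133)"*),
(3.137)–(3.138) p. 423; [3] (2.51)–(2.56) pp. 232–233, Lemma 2.1 (2.61) p. 234.

WHY THIS FILE (audit cell `pub-balaban`, BINDER row (D4), OWNER lineage `b2b-balaban-beta-an4`, gen 106).  NODE D of the row at the
origin — the block majorant of `(δ/δB)𝓗(0) = H₀ + G̃Δ⁽²⁾H₀` (`Beta.RemainderChartOriginDerivative.fderiv_chartH179_zero`), consumed
as `Data190.h190` — was assembled by `Beta.RemainderOriginBaseLetters.ineq190_origin_of_base_letters` (gen 105) from THREE analytic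
letters of [5]-shape in the background field: `hH0` ((3.133) for `H₀`), `hG0` (Thm 3.3 (3.42), first entry, for `G₀ = Δ_a⁻¹`),
`hInv` ((3.132)-shape for `(QG′Q*)⁻¹` with the new `G′`).  Its §1b reduced `hH0` to `hG0` + a (3.132)-shape letter `hInv₀` of
`(QG₀Q*)⁻¹`; `Beta.RemainderInvQGQNewG.hasMaj_invQGQ_newG` (gen 106) reduces `hInv` to `hG0` + `hInv₀` as well.  THIS FILE
composes the two reductions with the assembly: **the (190) letter of NODE D at the origin in a background from `hG0` and `hInv₀`
ALONE** — plus the localities of `Δ⁽²⁾`, `Q`, `Q*` and of the source scaling `J : B ↦ (L^{j}η)⁻¹B`, the invertibility relations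
(`G′ = G₀ + G₀Δ⁽²⁾G′`, `Inv′ = Inv₀ − Inv₀PInv′`, a priori bounds — all automatic on finite carriers), (2.54) + (2.61), and TWO
smallnesses `q, q_I < 1`, both linear in the (3.137) factor `λ` of `Δ⁽²⁾` (*"Δ⁽²⁾ is a small perturbation of Δ_a"*).
* §1 **`hasMaj_origin_of_two_letters`** ∕ **`ineq190_origin_of_two_letters`** (abstract block-normed spaces): `Ineq190 bB bN
  (H₀ + G̃Δ⁽²⁾H₀) (A₀ + κ₃B_G̃θ_Dc) δ` for `δ/8 ≤ ρ`, `ρ + 5σ ≤ min(δ₁, δ_I)`; rate ladder: `H₀` read at `ρ`, `G′` at `ρ + 4σ`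
  (and again at `ρ + 2σ` inside the assembly), the perturbation `P = Q·G₀Δ⁽²⁾G′·Q*` at `ρ + 4σ`, `(QG′Q*)⁻¹` at `ρ + 3σ`, `G̃` at
  `ρ + σ`, the product at `ρ`; every constant bound to its closed form by a `h…` hypothesis (instantiate with `rfl`).
* §2 **`exists_invQGQ_supSize`** (finite carriers, the sup sizes of (190) on the fields `X → E` AND on the `Q`-images `X_Q → E_Q`,
  `κ = 1`): given the two-sided inverse `Inv₀` of `QG₀Q*`, the new `G′` with its first entry, and `q_I = B_Iθ_Pc² < 1`, the operator
  `(QG′Q*)⁻¹` EXISTS as a two-sided inverse solving `Inv′ = Inv₀ − Inv₀PInv′` (`‖Inv₀P‖ ≤ q_I` by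
  `Beta.RemainderOriginBaseLetters.opNorm_le_of_hasMaj_supSize`; `Beta.RemainderInvQGQNewG.exists_inv_of_perturbation`) and has the majorant
  `B_I(1 − q_I)⁻¹e^{−ρd}` — p. 306's sentence for `(QG′Q*)⁻¹`, CONSTRUCTED.
LETTER LIST OF NODE D AT THE ORIGIN IN A BACKGROUND after this file: **(L2) `hG0`** — [5] Thm 3.3 (3.42), first entry, for the
BOND operator `Δ_a⁻¹ = (Δ + DRD* + Q*Q)⁻¹` in the background (tree: `B9.Thm33Printed`, statement only; the NE9 programme's
`B9Eq342*` prove Thm 3.1's SITE operator) — and **`hInv₀`** — the (3.132)-SHAPE bound of `(QG₀Q*)⁻¹` ([5] p. 422 prints (3.132) for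
the Sect.-D operator and says *"(QGQ*)⁻¹ … can be analyzed in the same way as the operator (Q′G′²Q′*)⁻¹. We will not repeat these
considerations here"*; for the `Δ_a⁻¹` of [15] the tree's `QGQInverse.inverse_decay` is the finite Combes–Thomas mechanism reducing
it to the kernel decay of `QG₀Q*` (⇐ Thm 3.3 + `Q`, `Q*` local) and a coercivity bound `QG₀Q* ≥ γ`, GAPS G-IF-02); everything else
on the list is structural (localities, invertibility, (2.54)/(2.61)) or a smallness in `λ`.

HONEST SCOPE.  Bookkeeping: [folklore] compositions of `Beta.RemainderOriginBaseLetters` §§1b, 2, 4 with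
`Beta.RemainderInvQGQNewG` §§2–4; NO estimate of [5] or [15] is proved; `hG0`, `hInv₀` stay hypotheses of the printed SHAPE; nothing
identifies Bałaban's step-`k` operators with tree terms (NODE O); the rate ladder and constants are this file's, absorbed in print's
*"O(1)"*, *"δ₀"* (cell DIVERGENCE D-B11-25).  Row (D4) class UNCHANGED (instance 0∕1; D4 DISCHARGE NO DATE); NOT B12 Thm 2, NOT
BetaPertH, NOT continuum, NOT Clay.  HONEST DEPENDENCY (cell line): continuum YM on T⁴ ⇐ BetaPertH ∧ nine spine estimates (0/9
proved); BetaPertH ⇐ (D1) ∧ (D4) ∧ CAP+tail; G-an2-4 gates asym, D1 and NE2/3/4.  NEW file; nothing modified; 0 `def`; standard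
axioms; no `sorry`.
-/

namespace Literature.MathematicalPhysics.QuantumFieldTheory.Balaban1983to89.Beta.RemainderOriginTwoLetters

open Literature.MathematicalPhysics.QuantumFieldTheory.Balaban1983to89
open Finset B6RandomWalk B11SectG B11Reparam190 B11SupSize190
open Beta.RemainderOriginBaseLetters Beta.RemainderInvQGQNewG

variable {g : B6.Geometry}

/-! ## §1  NODE D at the origin in a background from TWO letters: `hG0` and `hInv₀` -/

section TwoLetters

variable {FB FA F3 FQ : Type} [AddCommGroup FB] [Module ℝ FB] [AddCommGroup FA] [Module ℝ FA]
  [AddCommGroup F3] [Module ℝ F3] [AddCommGroup FQ] [Module ℝ FQ]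

/-- **THE MAJORANT OF `(δ/δB)𝓗(0) = H₀ + G̃Δ⁽²⁾H₀` FROM [5] THM 3.3 FOR `Δ_a⁻¹` AND THE (3.132)-SHAPE BOUND OF `(QG₀Q*)⁻¹`.**
Setting ((115): `Δ_a : FA → F3`; `G₀, G′ : F3 → FA`; `Δ⁽²⁾ : FA → F3`; `Q : FA → FQ`, `Q* : FQ → F3`; the B-data in `FB`; block
sizes `bB`, `bN`, `b3` and the two `Q`-sizes `bQ`, `bQ′` absorbing the weights of (3.132)).  ANALYTIC LETTERS (two): `hG0` — `G₀`
of majorant `Be^{−δ₁d}` ((3.42), first entry: p. 297 *"For the operator Δ_a⁻¹ = G we have proved Theorem 3.3 in [5]"*); `hInv0` —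
`Inv₀ = (QG₀Q*)⁻¹` of majorant `B_Ie^{−δ_Id}` (the shape of (3.132)).  STRUCTURE: `H₀ = G₀Q*·Inv₀·J` ((129), `J` = the source
scaling `B ↦ (L^{j(·)}η)⁻¹B` read into the `Q`-size — LOCAL, range `r_J`, column sums `ν_J`); `Δ⁽²⁾` LOCAL (range `r_D`, row AND
column sums `≤ λ` — (3.137)); `Q`, `Q*` LOCAL (range `r_Q`, row sums `ν_Q` ∕ column sums `ν_{Q*}`); the resolvent identities
`G′ = G₀ + G₀Δ⁽²⁾G′` (p. 306; from `G₀Δ_a = 1`, `(Δ_a − Δ⁽²⁾)G′ = 1` by `newG_fix_of_inverse`) and `Inv′ = Inv₀ − Inv₀·P·Inv′`,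
`P = Q·G₀Δ⁽²⁾G′·Q*` (from `Inv₀QG₀Q* = 1`, `QG′Q*·Inv′ = 1` by `inv_fix_of_perturbation` + `qgq_newG_eq`) with a priori bounds
`M₀`, `M_I` (automatic on finite carriers); `G̃ = G′ − G′Q*·Inv′·QG′` ((131)/(143)/(180)); (2.54) and the row sum (2.61) of Lemma
2.1 [3] at the rate `σ ≥ 0` with constant `c ≥ 0`; TWO smallnesses `q = κ_Nκ₃Bλe^{δ₁r_D}c < 1` and `q_I = κ_{Q′}κ_QB_Iθ_Pc² < 1`
(`θ_P` linear in `λ`: *"Δ⁽²⁾ is a small perturbation of Δ_a"*).  CONCLUSION: for `ρ ≥ 0` with `ρ + 5σ ≤ δ₁`, `ρ + 5σ ≤ δ_I`, the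
operator `H₀ + G̃Δ⁽²⁾H₀` has the majorant `(A₀ + κ₃B_G̃θ_Dc)·e^{−ρd}` from `bB` into `bN`, where `A₀` (the DERIVED (3.133)
constant, `hasMaj_H0_of_base_letters`), `θ_D`, `B_{G′} = B(1 − q)⁻¹`, `θ_P`, `q_I`, `B_I′ = B_I(1 − q_I)⁻¹` (the DERIVED (3.132)
constant of `(QG′Q*)⁻¹`, `hasMaj_invQGQ_newG`) and `B_G̃` are bound to their closed forms by `hA₀ … hBGt` (instantiate with `rfl`).
[cite: Balaban1985Variational, (129)–(131) pp.297–298, (143) p.300, p.306 after (179), (180) p.306, (182) p.307, (190) p.308; Balaban1985BackgroundPropagators, Thm 3.3 (3.42) p.397+p.399, (3.132)–(3.133) p.422, (3.137)–(3.138) p.423; Balaban1984PropagatorsII, (2.54) p.233, Lemma 2.1 (2.61) p.234] -/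
theorem hasMaj_origin_of_two_letters
    {bB : BlockNorm g FB} {bN : BlockNorm g FA} {b3 : BlockNorm g F3} {bQ bQ' : BlockNorm g FQ}
    {H0 : FB →ₗ[ℝ] FA} {D2 : FA →ₗ[ℝ] F3} {G0 G' Gt : F3 →ₗ[ℝ] FA} {Q : FA →ₗ[ℝ] FQ} {Qs : FQ →ₗ[ℝ] F3}
    {Inv0 Inv' : FQ →ₗ[ℝ] FQ} {J : FB →ₗ[ℝ] FQ} {KD KQ KQs KJ : g.Site → g.Site → ℝ}
    {B δ₁ BI δI M₀ MI lam rD νQ νs rQ νJ rJ ρ σ c A₀ θD q BG' θP qI BI' BGt : ℝ}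
    (htri : Triangle254 g) (hd : ∀ a b : g.Site, 0 ≤ g.dist a b) (hrow : RowSum g σ c) (hc : 0 ≤ c)
    (hσ : 0 ≤ σ) (hρ : 0 ≤ ρ) (hρ₁ : ρ + 5 * σ ≤ δ₁) (hρI : ρ + 5 * σ ≤ δI)
    (hB : 0 ≤ B) (hBI : 0 ≤ BI) (hM₀ : 0 ≤ M₀) (hMI : 0 ≤ MI) (hlam : 0 ≤ lam)
    (hνQ : 0 ≤ νQ) (hνs : 0 ≤ νs) (hνJ : 0 ≤ νJ)
    -- the two analytic letters
    (hG0 : HasMaj b3 bN G0 (fun a b => B * Real.exp (-(δ₁ * g.dist a b))))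
    (hInv0 : HasMaj bQ bQ' Inv0 (fun a b => BI * Real.exp (-(δI * g.dist a b))))
    -- H₀ = G₀Q*(QG₀Q*)⁻¹J with the source scaling J local
    (hH0def : H0 = ((G0 ∘ₗ Qs) ∘ₗ Inv0) ∘ₗ J)
    (hKJ : ∀ a b, 0 ≤ KJ a b) (hJloc : ∀ a b, KJ a b ≠ 0 → g.dist a b ≤ rJ)
    (hJcol : ∀ b, ∑ a : g.Site, KJ a b ≤ νJ) (hJ : HasMaj bB bQ J KJ)
    -- Δ⁽²⁾ local
    (hKD : ∀ a b, 0 ≤ KD a b) (hDloc : ∀ a b, KD a b ≠ 0 → g.dist a b ≤ rD)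
    (hDrow : ∀ a, ∑ b : g.Site, KD a b ≤ lam) (hDcol : ∀ b, ∑ a : g.Site, KD a b ≤ lam)
    (hD2 : HasMaj bN b3 D2 KD)
    -- the new G′: resolvent identity, a priori bound, smallness
    (hfix : G' = G0 + (G0 ∘ₗ D2) ∘ₗ G') (hap : HasMaj b3 bN G' (fun _ _ => M₀))
    (hq_def : q = bN.κ * (b3.κ * B * lam * Real.exp (δ₁ * rD)) * c) (hq : q < 1) (hBG' : BG' = B * (1 - q)⁻¹)
    -- Q, Q* local
    (hKQ : ∀ a b, 0 ≤ KQ a b) (hQloc : ∀ a b, KQ a b ≠ 0 → g.dist a b ≤ rQ)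
    (hQrow : ∀ a, ∑ b : g.Site, KQ a b ≤ νQ) (hQ : HasMaj bN bQ Q KQ)
    (hKQs : ∀ a b, 0 ≤ KQs a b) (hQsloc : ∀ a b, KQs a b ≠ 0 → g.dist a b ≤ rQ)
    (hQscol : ∀ b, ∑ a : g.Site, KQs a b ≤ νs) (hQs : HasMaj bQ' b3 Qs KQs)
    -- (QG′Q*)⁻¹: second resolvent identity, a priori bound, smallness
    (hfixI : Inv' = Inv0 - (Inv0 ∘ₗ (Q ∘ₗ (((G0 ∘ₗ D2) ∘ₗ G') ∘ₗ Qs))) ∘ₗ Inv')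
    (hapI : HasMaj bQ bQ' Inv' (fun _ _ => MI))
    (hθP : θP = bN.κ * (b3.κ * (bN.κ * (b3.κ * B * lam * Real.exp (δ₁ * rD)) * BG' * c) * νs *
      Real.exp ((ρ + 4 * σ) * rQ)) * νQ * Real.exp ((ρ + 4 * σ) * rQ))
    (hqI : qI = bQ'.κ * (bQ.κ * BI * θP * c) * c) (hqI1 : qI < 1) (hBI' : BI' = BI * (1 - qI)⁻¹)
    -- G̃ = G′P₀′*
    (hGt : Gt = G' - (G' ∘ₗ Qs) ∘ₗ Inv' ∘ₗ (Q ∘ₗ G'))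
    -- the derived constants
    (hA₀ : A₀ = bQ'.κ * (b3.κ * B * νs * Real.exp (δ₁ * rQ)) * (bQ.κ * BI * νJ * Real.exp (δI * rJ)) * c)
    (hθD : θD = bN.κ * A₀ * lam * Real.exp (ρ * rD))
    (hBGt : BGt = BG' + bN.κ * b3.κ * bQ.κ * bQ'.κ * νQ * νs * BI' * BG' * BG' *
      Real.exp ((ρ + 2 * σ) * rQ) * Real.exp ((ρ + 2 * σ) * rQ) * c * c) :
    HasMaj bB bN (H0 + Gt ∘ₗ (D2 ∘ₗ H0))
      (fun a b => (A₀ + b3.κ * BGt * θD * c) * Real.exp (-(ρ * g.dist a b))) := by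
  -- (L1) derived: H₀ at the rate ρ (Beta.RemainderOriginBaseLetters §1b)
  have hH0 : HasMaj bB bN H0 (fun a b => A₀ * Real.exp (-(ρ * g.dist a b))) := by
    rw [hA₀]
    exact hasMaj_H0_of_base_letters htri hd hrow hB hBI hνs hνJ hρ hσ (by linarith) (by linarith) hH0def hG0 hKQs
      hQsloc hQscol hQs hInv0 hKJ hJloc hJcol hJ
  have hA₀0 : 0 ≤ A₀ := by
    rw [hA₀]
    have := bQ'.κ_nonneg; have := b3.κ_nonneg; have := bQ.κ_nonneg
    positivity
  -- the new G′ at the rate ρ + 4σ (Beta.RemainderOriginBaseLetters §2)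
  have hq0 : 0 ≤ q := by
    rw [hq_def]
    exact mul_nonneg (mul_nonneg bN.κ_nonneg
      (mul_nonneg (mul_nonneg (mul_nonneg b3.κ_nonneg hB) hlam) (Real.exp_nonneg _))) hc
  have hBG'0 : 0 ≤ BG' := by rw [hBG']; exact mul_nonneg hB (inv_nonneg.mpr (by linarith))
  have hG' : HasMaj b3 bN G' (fun a b => BG' * Real.exp (-((ρ + 4 * σ) * g.dist a b))) := by
    rw [hBG', hq_def]
    exact hasMaj_newG_of_fix_local htri hd hrow hB hM₀ hlam (by linarith) hσ (by linarith) hKD hDloc hDcol hG0 hD2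
      hfix hap (by rw [← hq_def]; exact hq)
  -- (L3) derived: (QG′Q*)⁻¹ at the rate ρ + 3σ (Beta.RemainderInvQGQNewG §3, perturbation read at ρ + 4σ)
  have hInv : HasMaj bQ bQ' Inv' (fun a b => BI' * Real.exp (-((ρ + 3 * σ) * g.dist a b))) := by
    rw [hBI']
    exact hasMaj_invQGQ_newG htri hd hrow hc hB hBG'0 hBI hMI hlam hνQ hνs hσ (by linarith) (by linarith) le_rfl
      (by linarith) (by linarith) hKD hDloc hDcol hD2 hG0 hG' hKQ hQloc hQrow hQ hKQs hQsloc hQscol hQs hInv0 hfixI hapI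
      hθP hqI hqI1
  have hqI0 : 0 ≤ qI := by
    rw [hqI]
    have hθP0 : 0 ≤ θP := by
      rw [hθP]
      have := bN.κ_nonneg; have := b3.κ_nonneg
      positivity
    have := bQ'.κ_nonneg; have := bQ.κ_nonneg
    positivity
  have hBI'0 : 0 ≤ BI' := by rw [hBI']; exact mul_nonneg hBI (inv_nonneg.mpr (by linarith))
  -- the assembly (Beta.RemainderOriginBaseLetters §4) with δ₀ := ρ, δ_I := ρ + 3σ
  exact hasMaj_origin_of_base_letters htri hd hrow hc hσ hρ le_rfl (by linarith) le_rfl hA₀0 hρ hB hM₀ hBI'0 hlam hνQ hνs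
    hH0 hKD hDloc hDrow hDcol hD2 hG0 hfix hap hq_def hq hBG' hGt hKQ hQloc hQrow hQ hKQs hQsloc hQscol hQs hInv hBGt hθD

/-- **THE (190) LETTER OF `(δ/δB)𝓗(0) = H₀ + G̃Δ⁽²⁾H₀` FROM TWO LETTERS**: under the hypotheses of `hasMaj_origin_of_two_letters`,
`Ineq190 bB bN (H₀ + G̃Δ⁽²⁾H₀) (A₀ + κ₃B_G̃θ_Dc) δ` for every `δ` with `δ/8 ≤ ρ` — entries `n = 0, 1` of (190) at the origin, in the
currency of `B11SectG.ineq190_of_189` ∕ the row's `Data190.h190`, with the located analytic inputs EXACTLY [5] Thm 3.3 (3.42) for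
`Δ_a⁻¹` in the background and the (3.132)-shape bound of `(QG₀Q*)⁻¹`; NO (189), NO (187)–(188), NO separate letter of `H₀`, `G′`,
`(QG′Q*)⁻¹`, `G̃`, `H` or `𝔇`. [cite: Balaban1985Variational, (182) p.307, (190) p.308, (129) p.297, p.306 after (179); Balaban1985BackgroundPropagators, Thm 3.3 (3.42) p.397+p.399, (3.132)–(3.133) p.422, (3.137) p.423; Balaban1984PropagatorsII, Lemma 2.1 (2.61) p.234] -/
theorem ineq190_origin_of_two_letters
    {bB : BlockNorm g FB} {bN : BlockNorm g FA} {b3 : BlockNorm g F3} {bQ bQ' : BlockNorm g FQ}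
    {H0 : FB →ₗ[ℝ] FA} {D2 : FA →ₗ[ℝ] F3} {G0 G' Gt : F3 →ₗ[ℝ] FA} {Q : FA →ₗ[ℝ] FQ} {Qs : FQ →ₗ[ℝ] F3}
    {Inv0 Inv' : FQ →ₗ[ℝ] FQ} {J : FB →ₗ[ℝ] FQ} {KD KQ KQs KJ : g.Site → g.Site → ℝ}
    {B δ₁ BI δI M₀ MI lam rD νQ νs rQ νJ rJ ρ σ c A₀ θD q BG' θP qI BI' BGt δ : ℝ}
    (htri : Triangle254 g) (hd : ∀ a b : g.Site, 0 ≤ g.dist a b) (hrow : RowSum g σ c) (hc : 0 ≤ c)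
    (hσ : 0 ≤ σ) (hρ : 0 ≤ ρ) (hρ₁ : ρ + 5 * σ ≤ δ₁) (hρI : ρ + 5 * σ ≤ δI) (hδ : δ / 8 ≤ ρ)
    (hB : 0 ≤ B) (hBI : 0 ≤ BI) (hM₀ : 0 ≤ M₀) (hMI : 0 ≤ MI) (hlam : 0 ≤ lam)
    (hνQ : 0 ≤ νQ) (hνs : 0 ≤ νs) (hνJ : 0 ≤ νJ)
    (hG0 : HasMaj b3 bN G0 (fun a b => B * Real.exp (-(δ₁ * g.dist a b))))
    (hInv0 : HasMaj bQ bQ' Inv0 (fun a b => BI * Real.exp (-(δI * g.dist a b))))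
    (hH0def : H0 = ((G0 ∘ₗ Qs) ∘ₗ Inv0) ∘ₗ J)
    (hKJ : ∀ a b, 0 ≤ KJ a b) (hJloc : ∀ a b, KJ a b ≠ 0 → g.dist a b ≤ rJ)
    (hJcol : ∀ b, ∑ a : g.Site, KJ a b ≤ νJ) (hJ : HasMaj bB bQ J KJ)
    (hKD : ∀ a b, 0 ≤ KD a b) (hDloc : ∀ a b, KD a b ≠ 0 → g.dist a b ≤ rD)
    (hDrow : ∀ a, ∑ b : g.Site, KD a b ≤ lam) (hDcol : ∀ b, ∑ a : g.Site, KD a b ≤ lam)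
    (hD2 : HasMaj bN b3 D2 KD)
    (hfix : G' = G0 + (G0 ∘ₗ D2) ∘ₗ G') (hap : HasMaj b3 bN G' (fun _ _ => M₀))
    (hq_def : q = bN.κ * (b3.κ * B * lam * Real.exp (δ₁ * rD)) * c) (hq : q < 1) (hBG' : BG' = B * (1 - q)⁻¹)
    (hKQ : ∀ a b, 0 ≤ KQ a b) (hQloc : ∀ a b, KQ a b ≠ 0 → g.dist a b ≤ rQ)
    (hQrow : ∀ a, ∑ b : g.Site, KQ a b ≤ νQ) (hQ : HasMaj bN bQ Q KQ)
    (hKQs : ∀ a b, 0 ≤ KQs a b) (hQsloc : ∀ a b, KQs a b ≠ 0 → g.dist a b ≤ rQ)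
    (hQscol : ∀ b, ∑ a : g.Site, KQs a b ≤ νs) (hQs : HasMaj bQ' b3 Qs KQs)
    (hfixI : Inv' = Inv0 - (Inv0 ∘ₗ (Q ∘ₗ (((G0 ∘ₗ D2) ∘ₗ G') ∘ₗ Qs))) ∘ₗ Inv')
    (hapI : HasMaj bQ bQ' Inv' (fun _ _ => MI))
    (hθP : θP = bN.κ * (b3.κ * (bN.κ * (b3.κ * B * lam * Real.exp (δ₁ * rD)) * BG' * c) * νs *
      Real.exp ((ρ + 4 * σ) * rQ)) * νQ * Real.exp ((ρ + 4 * σ) * rQ))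
    (hqI : qI = bQ'.κ * (bQ.κ * BI * θP * c) * c) (hqI1 : qI < 1) (hBI' : BI' = BI * (1 - qI)⁻¹)
    (hGt : Gt = G' - (G' ∘ₗ Qs) ∘ₗ Inv' ∘ₗ (Q ∘ₗ G'))
    (hA₀ : A₀ = bQ'.κ * (b3.κ * B * νs * Real.exp (δ₁ * rQ)) * (bQ.κ * BI * νJ * Real.exp (δI * rJ)) * c)
    (hθD : θD = bN.κ * A₀ * lam * Real.exp (ρ * rD))
    (hBGt : BGt = BG' + bN.κ * b3.κ * bQ.κ * bQ'.κ * νQ * νs * BI' * BG' * BG' *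
      Real.exp ((ρ + 2 * σ) * rQ) * Real.exp ((ρ + 2 * σ) * rQ) * c * c) :
    Ineq190 bB bN (H0 + Gt ∘ₗ (D2 ∘ₗ H0)) (A₀ + b3.κ * BGt * θD * c) δ := by
  have h := hasMaj_origin_of_two_letters htri hd hrow hc hσ hρ hρ₁ hρI hB hBI hM₀ hMI hlam hνQ hνs hνJ hG0 hInv0 hH0def hKJ
    hJloc hJcol hJ hKD hDloc hDrow hDcol hD2 hfix hap hq_def hq hBG' hKQ hQloc hQrow hQ hKQs hQsloc hQscol hQs hfixI hapI hθP hqI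
    hqI1 hBI' hGt hA₀ hθD hBGt
  -- the constant is non-negative: read it off the majorant of a localized input (vacuous if 𝔅 is empty)
  intro y' μ hμ y
  have hC : 0 ≤ A₀ + b3.κ * BGt * θD * c := by
    have hA₀0 : 0 ≤ A₀ := by
      rw [hA₀]
      have := bQ'.κ_nonneg; have := b3.κ_nonneg; have := bQ.κ_nonneg
      positivity
    have hq0 : 0 ≤ q := by
      rw [hq_def]
      exact mul_nonneg (mul_nonneg bN.κ_nonneg
        (mul_nonneg (mul_nonneg (mul_nonneg b3.κ_nonneg hB) hlam) (Real.exp_nonneg _))) hc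
    have hBG'0 : 0 ≤ BG' := by rw [hBG']; exact mul_nonneg hB (inv_nonneg.mpr (by linarith))
    have hθP0 : 0 ≤ θP := by
      rw [hθP]
      have := bN.κ_nonneg; have := b3.κ_nonneg
      positivity
    have hqI0 : 0 ≤ qI := by
      rw [hqI]
      have := bQ'.κ_nonneg; have := bQ.κ_nonneg
      positivity
    have hBI'0 : 0 ≤ BI' := by rw [hBI']; exact mul_nonneg hBI (inv_nonneg.mpr (by linarith))
    have hθD0 : 0 ≤ θD := by
      rw [hθD]; exact mul_nonneg (mul_nonneg (mul_nonneg bN.κ_nonneg hA₀0) hlam) (Real.exp_nonneg _)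
    have hBGt0 : 0 ≤ BGt := by
      rw [hBGt]
      have := bN.κ_nonneg; have := b3.κ_nonneg; have := bQ.κ_nonneg; have := bQ'.κ_nonneg
      positivity
    have := b3.κ_nonneg
    positivity
  refine (h y' μ hμ y).trans (mul_le_mul_of_nonneg_right ?_ (bB.loc_nonneg _ _))
  exact mul_le_mul_of_nonneg_left (Real.exp_le_exp.mpr (by nlinarith [hd y y'])) hC

end TwoLetters

/-! ## §2  Finite carriers: `(QG′Q*)⁻¹` EXISTS under the second smallness and has the (3.132)-shape majorant -/

section SupSize

variable {X : Type} {E : Type} [NormedAddCommGroup E] [NormedSpace ℂ E]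
  {box : g.Site → Finset X} {blk : X → g.Site}
  {XQ : Type} [Fintype XQ] {EQ : Type} [NormedAddCommGroup EQ] [NormedSpace ℂ EQ] [CompleteSpace EQ]
  {boxQ : g.Site → Finset XQ} {blkQ : XQ → g.Site}

/-- **p. 306, KERNEL-CHECKED ON FINITE CARRIERS: `(QG′Q*)⁻¹` EXISTS AND *"has exactly the same properties"* as `(QG₀Q*)⁻¹`.**
Fields `X → E` and `Q`-images `X_Q → E_Q` (`X_Q` finite, sup norms; the sup sizes of (190) `S`, `S_Q` with boxes = fibres of
the block maps, `κ = 1`); all operators continuous linear over `ℂ`, majorants read on their real restrictions.  GIVEN: `G₀` of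
majorant `Be^{−δ₁d}` ((3.42), first entry); the new `G′` with `G′ = G₀ + G₀Δ⁽²⁾G′` (as `Beta.RemainderOriginBaseLetters.exists_newG_supSize`
delivers it) and its first entry `B_{G′}e^{−δ_{G′}d}`; `Δ⁽²⁾` LOCAL (range `r_D`, column sums `≤ λ`); `Q`, `Q*` LOCAL (range `r_Q`,
row sums `ν_Q` ∕ column sums `ν_{Q*}`); `Inv₀` a two-sided inverse of `QG₀Q*` of majorant `B_Ie^{−δ_Id}`; the row sum (2.61) at a
rate `σ ≥ 0` with constant `c ≥ 0`; rates `σ ≤ ρ₁ ≤ δ_{G′}`, `ρ₁ + σ ≤ δ₁`, `2σ ≤ δ_I`; and `q_I := B_Iθ_Pc² < 1`, `θ_P` the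
constant of `Beta.RemainderInvQGQNewG.hasMaj_qgq_perturbation` at `κ = 1`.  THEN `‖Inv₀·P‖ ≤ q_I < 1` for `P = Q·G₀Δ⁽²⁾G′·Q*` (sup
operator norm, `opNorm_le_of_hasMaj_supSize`), so `Inv′ := (1 + Inv₀P)⁻¹Inv₀` is a two-sided inverse of `QG′Q* = QG₀Q* + P`
solving `Inv′ = Inv₀ − Inv₀PInv′` (`exists_inv_of_perturbation`), and for every `ρ ≥ 0` with `ρ + σ ≤ ρ₁`, `ρ + 2σ ≤ δ_I` it has
the majorant `B_I(1 − q_I)⁻¹e^{−ρd}` (`hasMaj_invQGQ_newG`, the a priori bound being automatic, `hasMaj_supSize_const_of_opNorm`).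
[cite: Balaban1985Variational, p.306 after (179), (129)–(131) pp.297–298, (187)–(188) p.308; Balaban1985BackgroundPropagators, (3.132) p.422, Thm 3.3 (3.42) p.397+p.399, (3.137)–(3.138) p.423; Balaban1984PropagatorsII, (2.52)–(2.53) p.232, Lemma 2.1 (2.61) p.234] -/
theorem exists_invQGQ_supSize (hboxQ : ∀ y x, x ∈ boxQ y ↔ blkQ x = y)
    (G0 G' D2 : (X → E) →L[ℂ] (X → E)) (Q : (X → E) →L[ℂ] (XQ → EQ)) (Qs : (XQ → EQ) →L[ℂ] (X → E))
    (Inv0 : (XQ → EQ) →L[ℂ] (XQ → EQ))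
    (hleft : Inv0 * (Q.comp (G0.comp Qs)) = 1) (hright : (Q.comp (G0.comp Qs)) * Inv0 = 1)
    (hfixG : G' = G0 + G0 * D2 * G')
    {KD KQ KQs : g.Site → g.Site → ℝ} {B BG' BI δ₁ δG' δI ρ₁ σ c rD lam rQ νQ νs θP qI : ℝ}
    (htri : Triangle254 g) (hd : ∀ a b : g.Site, 0 ≤ g.dist a b) (hrow : RowSum g σ c) (hc : 0 ≤ c)
    (hB : 0 ≤ B) (hBG' : 0 ≤ BG') (hBI : 0 ≤ BI) (hlam : 0 ≤ lam) (hνQ : 0 ≤ νQ) (hνs : 0 ≤ νs)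
    (hσ : 0 ≤ σ) (hσρ₁ : σ ≤ ρ₁) (hρ₁G : ρ₁ ≤ δG') (hρ₁δ : ρ₁ + σ ≤ δ₁) (hσI : 2 * σ ≤ δI)
    (hKD : ∀ a b, 0 ≤ KD a b) (hDloc : ∀ a b, KD a b ≠ 0 → g.dist a b ≤ rD)
    (hDcol : ∀ b, ∑ a : g.Site, KD a b ≤ lam)
    (hD2 : HasMaj (supSize g box blk) (supSize g box blk) (D2.restrictScalars ℝ : (X → E) →ₗ[ℝ] (X → E)) KD)
    (hG0 : HasMaj (supSize g box blk) (supSize g box blk) (G0.restrictScalars ℝ : (X → E) →ₗ[ℝ] (X → E))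
      (fun a b => B * Real.exp (-(δ₁ * g.dist a b))))
    (hG' : HasMaj (supSize g box blk) (supSize g box blk) (G'.restrictScalars ℝ : (X → E) →ₗ[ℝ] (X → E))
      (fun a b => BG' * Real.exp (-(δG' * g.dist a b))))
    (hKQ : ∀ a b, 0 ≤ KQ a b) (hQloc : ∀ a b, KQ a b ≠ 0 → g.dist a b ≤ rQ)
    (hQrow : ∀ a, ∑ b : g.Site, KQ a b ≤ νQ)
    (hQ : HasMaj (supSize g box blk) (supSize g boxQ blkQ) (Q.restrictScalars ℝ : (X → E) →ₗ[ℝ] (XQ → EQ)) KQ)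
    (hKQs : ∀ a b, 0 ≤ KQs a b) (hQsloc : ∀ a b, KQs a b ≠ 0 → g.dist a b ≤ rQ)
    (hQscol : ∀ b, ∑ a : g.Site, KQs a b ≤ νs)
    (hQs : HasMaj (supSize g boxQ blkQ) (supSize g box blk) (Qs.restrictScalars ℝ : (XQ → EQ) →ₗ[ℝ] (X → E)) KQs)
    (hInv0 : HasMaj (supSize g boxQ blkQ) (supSize g boxQ blkQ) (Inv0.restrictScalars ℝ : (XQ → EQ) →ₗ[ℝ] (XQ → EQ))
      (fun a b => BI * Real.exp (-(δI * g.dist a b))))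
    (hθP : θP = B * lam * Real.exp (δ₁ * rD) * BG' * c * νs * Real.exp (ρ₁ * rQ) * νQ * Real.exp (ρ₁ * rQ))
    (hqI : qI = BI * θP * c * c) (hqI1 : qI < 1) :
    ∃ Inv' : (XQ → EQ) →L[ℂ] (XQ → EQ),
      Inv' * (Q.comp (G'.comp Qs)) = 1 ∧ (Q.comp (G'.comp Qs)) * Inv' = 1 ∧
      Inv' = Inv0 - Inv0 * (Q.comp ((G0 * D2 * G').comp Qs)) * Inv' ∧
      ‖Inv0 * (Q.comp ((G0 * D2 * G').comp Qs))‖ ≤ qI ∧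
      ∀ ρ : ℝ, 0 ≤ ρ → ρ + σ ≤ ρ₁ → ρ + 2 * σ ≤ δI →
        HasMaj (supSize g boxQ blkQ) (supSize g boxQ blkQ) (Inv'.restrictScalars ℝ : (XQ → EQ) →ₗ[ℝ] (XQ → EQ))
          (fun a b => BI * (1 - qI)⁻¹ * Real.exp (-(ρ * g.dist a b))) := by
  have hρ₁ : 0 ≤ ρ₁ := hσ.trans hσρ₁
  -- abbreviations for the real restrictions
  set SX : BlockNorm g (X → E) := supSize g box blk with hSX
  set SQ : BlockNorm g (XQ → EQ) := supSize g boxQ blkQ with hSQ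
  set P : (XQ → EQ) →L[ℂ] (XQ → EQ) := Q.comp ((G0 * D2 * G').comp Qs) with hP_def
  -- the resolvent identity of G′ over ℝ
  have hfixR : (G'.restrictScalars ℝ : (X → E) →ₗ[ℝ] (X → E)) =
      (G0.restrictScalars ℝ : (X → E) →ₗ[ℝ] (X → E)) +
        ((G0.restrictScalars ℝ : (X → E) →ₗ[ℝ] (X → E)) ∘ₗ (D2.restrictScalars ℝ : (X → E) →ₗ[ℝ] (X → E))) ∘ₗ
          (G'.restrictScalars ℝ : (X → E) →ₗ[ℝ] (X → E)) := by
    apply LinearMap.ext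
    intro f
    have e := congrArg (fun T : (X → E) →L[ℂ] (X → E) => T f) hfixG
    simpa using e
  -- the perturbation over ℝ is the composite of the restrictions
  have hPR : (P.restrictScalars ℝ : (XQ → EQ) →ₗ[ℝ] (XQ → EQ)) =
      (Q.restrictScalars ℝ : (X → E) →ₗ[ℝ] (XQ → EQ)) ∘ₗ
        ((((G0.restrictScalars ℝ : (X → E) →ₗ[ℝ] (X → E)) ∘ₗ (D2.restrictScalars ℝ : (X → E) →ₗ[ℝ] (X → E))) ∘ₗ
            (G'.restrictScalars ℝ : (X → E) →ₗ[ℝ] (X → E))) ∘ₗ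
          (Qs.restrictScalars ℝ : (XQ → EQ) →ₗ[ℝ] (X → E))) := by
    apply LinearMap.ext
    intro v
    rfl
  -- §2 of the sibling: the majorant of P at the rate ρ₁ (κ = 1 everywhere)
  have hPmaj : HasMaj SQ SQ (P.restrictScalars ℝ : (XQ → EQ) →ₗ[ℝ] (XQ → EQ))
      (fun a b => θP * Real.exp (-(ρ₁ * g.dist a b))) := by
    rw [hPR, hθP]
    have h := hasMaj_qgq_perturbation (bQ := SQ) (bQ' := SQ) htri hd hrow hc hB hBG' hlam hνs hσ hρ₁ hρ₁G hρ₁δ hKD hDloc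
      hDcol hD2 hG0 hG' hKQ hQloc hQrow hQ hKQs hQsloc hQscol hQs
    refine h.mono fun a b => le_of_eq ?_
    simp only [hSX, supSize_κ, one_mul]
  have hθP0 : 0 ≤ θP := by rw [hθP]; positivity
  -- Inv₀P at the rate σ and its operator norm
  have hK : HasMaj SQ SQ ((Inv0.restrictScalars ℝ : (XQ → EQ) →ₗ[ℝ] (XQ → EQ)) ∘ₗ
      (P.restrictScalars ℝ : (XQ → EQ) →ₗ[ℝ] (XQ → EQ)))
      (fun a b => SQ.κ * BI * θP * c * Real.exp (-(σ * g.dist a b))) :=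
    hasMaj_comp_exp htri hd hrow hBI hθP0 hσ hσρ₁ (by linarith) hInv0 hPmaj
  have hKnorm : ‖Inv0 * P‖ ≤ qI := by
    have hK' : HasMaj SQ SQ ((Inv0 * P).restrictScalars ℝ : (XQ → EQ) →ₗ[ℝ] (XQ → EQ))
        (fun a b => BI * θP * c * Real.exp (-(σ * g.dist a b))) := by
      refine (hK.congr fun v => rfl).mono fun a b => le_of_eq ?_
      simp only [hSQ, supSize_κ, one_mul]
    have h := opNorm_le_of_hasMaj_supSize hboxQ (Inv0 * P) (mul_nonneg (mul_nonneg hBI hθP0) hc) hc hrow hK'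
    rw [hqI]; exact h
  -- existence (Beta.RemainderInvQGQNewG §4)
  have hA : Q.comp (G'.comp Qs) = Q.comp (G0.comp Qs) + P := by
    rw [hP_def]
    refine ContinuousLinearMap.ext fun v => ?_
    have e := congrArg (fun T : (X → E) →L[ℂ] (X → E) => T (Qs v)) hfixG
    change Q (G' (Qs v)) = Q (G0 (Qs v)) + Q ((G0 * D2 * G') (Qs v))
    rw [← map_add]
    congr 1
  obtain ⟨Inv', h1, h2, h3⟩ := exists_inv_of_perturbation (Q.comp (G0.comp Qs)) P Inv0 hleft hright
    (hKnorm.trans_lt hqI1)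
  refine ⟨Inv', by rw [hA]; exact h1, by rw [hA]; exact h2, h3, hKnorm, ?_⟩
  intro ρ hρ hρρ₁ hρI
  -- the second resolvent identity over ℝ, the automatic a priori bound, and §3 of the sibling
  have hfixI : (Inv'.restrictScalars ℝ : (XQ → EQ) →ₗ[ℝ] (XQ → EQ)) =
      (Inv0.restrictScalars ℝ : (XQ → EQ) →ₗ[ℝ] (XQ → EQ)) -
        ((Inv0.restrictScalars ℝ : (XQ → EQ) →ₗ[ℝ] (XQ → EQ)) ∘ₗ
          ((Q.restrictScalars ℝ : (X → E) →ₗ[ℝ] (XQ → EQ)) ∘ₗ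
            ((((G0.restrictScalars ℝ : (X → E) →ₗ[ℝ] (X → E)) ∘ₗ (D2.restrictScalars ℝ : (X → E) →ₗ[ℝ] (X → E))) ∘ₗ
                (G'.restrictScalars ℝ : (X → E) →ₗ[ℝ] (X → E))) ∘ₗ
              (Qs.restrictScalars ℝ : (XQ → EQ) →ₗ[ℝ] (X → E))))) ∘ₗ
        (Inv'.restrictScalars ℝ : (XQ → EQ) →ₗ[ℝ] (XQ → EQ)) := by
    rw [← hPR]
    apply LinearMap.ext
    intro v
    have e := congrArg (fun T : (XQ → EQ) →L[ℂ] (XQ → EQ) => T v) h3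
    simpa using e
  have hapI := hasMaj_supSize_const_of_opNorm (g := g) hboxQ Inv'
  have h := hasMaj_invQGQ_newG (bQ := SQ) (bQ' := SQ) htri hd hrow hc hB hBG' hBI (norm_nonneg Inv') hlam hνQ hνs hσ hρ
    hρρ₁ hρ₁G hρ₁δ hρI hKD hDloc hDcol hD2 hG0 hG' hKQ hQloc hQrow hQ hKQs hQsloc hQscol hQs hInv0 hfixI hapI rfl rfl
    (by simpa only [hSX, hSQ, supSize_κ, one_mul, ← hθP, ← hqI] using hqI1)
  refine h.mono fun a b => le_of_eq ?_
  simp only [hSX, hSQ, supSize_κ, one_mul, ← hθP, ← hqI]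

end SupSize

end Literature.MathematicalPhysics.QuantumFieldTheory.Balaban1983to89.Beta.RemainderOriginTwoLetters
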